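import Literature.MathematicalPhysics.QuantumFieldTheory.Balaban1983to89.B11Eq110GreenLattice
import Literature.MathematicalPhysics.QuantumFieldTheory.Balaban1983to89.B11Eq45HOperator

/-!
# `Balaban1983to89.B11Eq45HOperatorLattice` — T. Bałaban, *The variational problem and background fields in renormalization group method
# for lattice gauge theories*, Commun. Math. Phys. **102** (1985) 277–309 [Balaban1985Variational], (45)–(46) p. 285 / (103) p. 293 / (110) p. 294:
# THE OPERATORS `H` / `H₁` AS CONTINUOUS LINEAR MAPS INTO THE SPACE (115) — REAL SCALARS — ASSEMBLED from the cell's two halves: the Hilbert-space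
# CONSTRUCTION `H₁ = G₁Q*(QG₁Q*)⁻¹` on Bałaban's lattice `L²` spaces (`B11Eq110GreenLattice.H1Lattice`, from the displayed positivity of `Δ_{1,a}`
# and `Q` onto) and the sup-norm KERNEL OPERATOR `B11Eq45HOperator.Hop` (whose H-kernel was a datum): the kernel is now `kernelOf` of the
# constructed operator, so `H`/`H₁ : |·|_{(−0)} → (115)` is an OBJECT modulo the printed data `Δ` (resp. `Δ₁`), `R`, `Q`, `a`, the transporters

statement-level skeleton of published theorems with citation tags; proofs where landed; nothing here is a claim about the
Yang–Mills mass gap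

PDF held: `paper:balaban1985-cmp102-variational-background` (journal page = PDF page + 276); p. 285 (PDF 9), pp. 293–295 (PDF 17–19) read as IMAGES
from the renders `pub-balaban/b2b-balaban-ref1/pages/1985-cmp102-variational-background/…-p009/p017/p018/p019-x2.png` by this seat (2026-08-21).

THE PRINT (p. 285, verbatim).  *«The operators Δ, Q and R define the operator H. Let us recall that it is an operator defined on configurations B
and giving a minimum of the quadratic form ½⟨A, ΔA⟩ under the restrictions L^jηQ_jA = B on Λ_j, j = 0, 1, …, k, RD*A = 0. Thus it has the following
properties L^jηQ_jHB = B on Λ_j, RD*HB = 0, (45) and the Theorem 3.12 from [5] implies |HB| ≤ B₀(L^jη)^{−1}|B|, |∇HB| ≤ B₀(L^jη)^{−2}|B| on Ω_j.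
(46)»*; p. 293: *«We take the operators H₁, 𝔓 defined by the operator Δ₁»*; p. 294: *«We denote by G₁ an inverse operator to the operator
Δ₁ + DRD* + aQ*Q»*.

WHY THIS FILE (cell context).  Letter (L4) of the pub-balaban NE9 letter map (owner's INTERFACE REQUEST NE9, HOME/INBOX.md [NE9P1-G76-RESULT]) asks
for `H` as a CLM `NegSize L η levB 0 V →L Space115 …`.  PART A/B (`B11Eq115KernelOp`, `B11Eq45HOperator`, p287172/p288058/p287488) type it as
the kernel operator of an H-KERNEL DATUM with (46) derived from kernel letters; the owner's gen-76 files (`B11Eq110GreenInverse` p287198,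
`B11Eq110GreenLattice` p287846) CONSTRUCT `H₁` — and, at the datum `Δ` instead of `Δ₁`, (45)'s `H` (the constructor is not specific to `Δ₁`)
— on the lattice `L²` spaces over ℝ.  THIS FILE joins them: the constructed operator, read on the flat carriers, has a kernel
(`B11Eq115KernelOp.kernelOf`), and `Hop` at that kernel is `H`/`H₁` INTO THE SPACE (115) with real scalars.  What then remains of the owner's
«ℝ/L² → ℂ/sup-norm transfer» (`B11Eq110GreenLattice` (M3)) for `H`/`H₁` is the complexification of the fibre only.
* §1 `H1flat hpos hQ : (β → W) →L[ℝ] (Bond d Pd → W)` — `H1Lattice` read on the flat carriers (block fields `F := WL2 ℝ wB W` on an index `β`);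
  `kernelH1 := kernelOf (H1flat …)` — THE H-KERNEL AS AN OBJECT; `kernelLM_kernelH1` (its kernel operator is `H1flat`).
* §2 **`HopLattice hpos hQ L η levB lev₀ lev₁ : NegSize L η levB 0 W →L[ℝ] Space115 L η lev₀ lev₁ (covGrad c R)`** := `Hop (𝕜 := ℝ) … (kernelH1 …)`;
  `equiv_HopLattice` (its values are `H1Lattice`'s); **`Q_HopLattice`** ((45), first member, FOR THE (115)-VALUED OBJECT: `Q` of `HB` read back in
  the `L²` carrier is `B` — hypothesis-free given the data); **`RDstar_H1Lattice`** / **`RDstar_HopLattice`** ((45), second member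
  `RD*HB = 0`, under the displayed [B9] (3.124) letter `RD*G₁Q* = 0` — the same letter `RDstar_frakGLattice` uses); **`norm_HopLattice_le`** ((46)-type bound `‖HB‖_{(115)} ≤ B₀‖B‖` from the two row-sum
  letters of the CONSTRUCTED kernel — the summed [B9] Thm 3.12 (3.133), displayed).
HONEST SCOPE.  Assembly of the cell's own constructions ([folklore] finite-dimensional linear algebra); DISPLAYED, never asserted: `hpos` ([B9]
Thm 3.11 for `Δ_a`/`Δ_{1,a}`), `hQ` (`Q` onto, [B9] (3.19)), the transporter data, the two row-sum letters ((3.133) summed); NOT typed: the complexification, the concrete `Q_j`/`R`/`Δ′`.  No inequality of the paper is proved.  Filed by the pub-balaban NE9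
leaf seat `b2b-balaban-t4-ne9-formalise-leaf-03` (gen 52) as (L4) PART C; NEW file, nothing of lit-balaban's or the owner's modified.  Net new
unproved facts: 0.
-/

noncomputable section

open scoped InnerProductSpace

namespace Literature.MathematicalPhysics.QuantumFieldTheory.Balaban1983to89.B11Eq45HOperatorLattice

open B11Eq110GreenLattice (laplaceALattice H1Lattice Q_H1Lattice hadj_adjoint adjoint_Q_injective)
open B11Eq110GreenInverse (G1 Kinv)
open B9Eq311L2Pairing (covDerivL2 covDivL2)
open B9Eq311L2Pairing (WL2 SiteL2 BondL2)
open B9Eq33CovDerivVector (covGrad)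
open B9SectCLatticeCarrier (Bond)
open B11Eq115Space B11Eq115KernelOp B11Eq45HOperator

variable {d : ℕ} {Pd : Fin d → ℕ} {W : Type*} [NormedAddCommGroup W] [InnerProductSpace ℝ W] [FiniteDimensional ℝ W] {c₀ : ℝ}
  [Fact (0 < c₀)] {β : Type*} [Fintype β] {wB : β → ℝ} [Fact (∀ y, 0 < wB y)]
  {c : ℝ} {R S : Bond d Pd → W →ₗ[ℝ] W} {Δ₁ : BondL2 d Pd c₀ W →ₗ[ℝ] BondL2 d Pd c₀ W}
  {Rr : SiteL2 d Pd c₀ W →ₗ[ℝ] SiteL2 d Pd c₀ W} {Q : BondL2 d Pd c₀ W →ₗ[ℝ] WL2 ℝ wB W} {a : ℝ}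
  (hpos : ∀ x : BondL2 d Pd c₀ W, x ≠ 0 → 0 < ⟪x, laplaceALattice c R S Δ₁ Rr Q a x⟫_ℝ) (hQ : Function.Surjective Q)

/-! ## §1 The constructed `H₁` on the flat carriers and ITS KERNEL -/

/-- **The constructed lattice operator `H₁ = G₁Q*(QG₁Q*)⁻¹` read on the flat carriers** `(β → W) → (Bond → W)` (the `L²` synonyms `WL2` are
`def`-copies of the Pi types; continuity by finite dimension).  With the Hessian datum `Δ` of (40)/(45) in the slot `Δ₁` this is (45)'s `H`.
[cite: Balaban1985Variational, (45) p.285, (103) p.293, (110) p.294] -/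
def H1flat : (β → W) →L[ℝ] (Bond d Pd → W) :=
  LinearMap.toContinuousLinearMap
    ((WL2.linearEquiv ℝ ℝ (fun _ : Bond d Pd => c₀)).toLinearMap ∘ₗ H1Lattice hpos hQ ∘ₗ
      ((WL2.linearEquiv ℝ ℝ wB).symm : (β → W) ≃ₗ[ℝ] WL2 ℝ wB W).toLinearMap)

/-- Unfolding: `H1flat b = H₁ b` through the identifications. [cite: Balaban1985Variational, (45) p.285] -/
theorem H1flat_apply (b : β → W) :
    H1flat hpos hQ b = WL2.equiv ℝ (fun _ : Bond d Pd => c₀) W (H1Lattice hpos hQ ((WL2.equiv ℝ wB W).symm b)) := rfl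

variable [DecidableEq β]

/-- **THE H-KERNEL AS AN OBJECT**: the kernel (matrix of fibre operators `W →L[ℝ] W`) of the constructed `H₁` — print's `H(x, y′)` of [5] (3.133),
here DETERMINED by the data `Δ₁` (or `Δ`), `R`, `Q`, `a`, the transporters and the two displayed facts. [cite: Balaban1985Variational, (46) p.285] -/
def kernelH1 : Bond d Pd → β → (W →L[ℝ] W) := kernelOf (H1flat hpos hQ)

/-- The kernel operator of `kernelH1` IS the constructed `H₁` (flat reading). [cite: Balaban1985Variational, (45) p.285] -/
theorem kernelLM_kernelH1 (b : β → W) : kernelLM (kernelH1 hpos hQ) b = H1flat hpos hQ b := kernelLM_kernelOf _ b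


omit [DecidableEq β] in
/-- **(45), second member, on the lattice: `RD*(H₁b) = 0`** from the displayed identity `RD*G₁Q* = 0` ([B9] (3.124) — the SAME letter
`B11Eq110GreenLattice.RDstar_frakGLattice` uses for `𝔊`): `RD*H₁b = (RD*G₁Q*)((QG₁Q*)⁻¹b) = 0`. [cite: Balaban1985Variational, (45) p.285; Balaban1985BackgroundPropagators, (3.124) p.420] -/
theorem RDstar_H1Lattice
    (h124' : Rr ∘ₗ covDivL2 c₀ c S ∘ₗ G1 Δ₁ (covDerivL2 c₀ c R) Rr (covDivL2 c₀ c S) Q (LinearMap.adjoint Q) a hpos ∘ₗ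
      LinearMap.adjoint Q = 0) (b : WL2 ℝ wB W) :
    Rr (covDivL2 c₀ c S (H1Lattice hpos hQ b)) = 0 := by
  have h := LinearMap.congr_fun h124' (Kinv hpos hadj_adjoint (adjoint_Q_injective hQ) b)
  simp only [LinearMap.comp_apply, LinearMap.zero_apply] at h
  exact h

/-! ## §2 `H` / `H₁` INTO THE SPACE (115), real scalars -/

section IntoSpace115

variable (L η : ℝ) [Fact (0 < L)] [Fact (0 < η)] (levB : β → ℕ) (lev₀ : Bond d Pd → ℕ) (lev₁ : Bond d Pd × Fin d → ℕ)

/-- **`H` / `H₁ : |·|_{(−0)} → (115)` AS AN OBJECT (real scalars)**: `B11Eq45HOperator.Hop` at the CONSTRUCTED kernel `kernelH1` — block fields `B`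
on `β` with the sup size ↦ `HB` in the space (115) normed by `max{|·|_{(−1)}, |∇^{U₀}·|_{(−2)}}`, `∇^{U₀} = covGrad c R`.
[cite: Balaban1985Variational, (45)–(46) p.285, (103) p.293] -/
def HopLattice : NegSize L η levB 0 W →L[ℝ] Space115 L η lev₀ lev₁ (covGrad c R) :=
  Hop (𝕜 := ℝ) L η levB lev₀ lev₁ c R (kernelH1 hpos hQ)

/-- **Its values are the constructed `H₁`'s**: `(HB)(b) = (H₁B)(b)` through the identifications. [cite: Balaban1985Variational, (45) p.285] -/
theorem equiv_HopLattice (B : NegSize L η levB 0 W) :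
    JetSup.equiv _ _ (covGrad c R) (HopLattice hpos hQ L η levB lev₀ lev₁ B) = H1flat hpos hQ (NegSup.equiv _ W B) := by
  funext b
  rw [HopLattice, equiv_Hop_apply, ← kernelLM_apply, kernelH1, kernelLM_kernelOf]

/-- **(45), first member, FOR THE (115)-VALUED OBJECT**: `Q` applied to `HB` (read back in the `L²` carrier) returns `B` — «L^jηQ_jHB = B on Λ_j»
with the weights inside `Q`, hypothesis-free given the data (`B11Eq110GreenLattice.Q_H1Lattice`). [cite: Balaban1985Variational, (45) p.285] -/
theorem Q_HopLattice (B : NegSize L η levB 0 W) :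
    WL2.equiv ℝ wB W (Q ((WL2.equiv ℝ (fun _ : Bond d Pd => c₀) W).symm
      (JetSup.equiv _ _ (covGrad c R) (HopLattice hpos hQ L η levB lev₀ lev₁ B)))) = NegSup.equiv _ W B := by
  rw [equiv_HopLattice, H1flat_apply, Equiv.symm_apply_apply, Q_H1Lattice]
  rfl


/-- **(45), second member, FOR THE (115)-VALUED OBJECT**: `RD*(HB) = 0` (read back in the `L²` carrier) under the displayed (3.124) letter
`RD*G₁Q* = 0`. [cite: Balaban1985Variational, (45) p.285; Balaban1985BackgroundPropagators, (3.124) p.420] -/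
theorem RDstar_HopLattice
    (h124' : Rr ∘ₗ covDivL2 c₀ c S ∘ₗ G1 Δ₁ (covDerivL2 c₀ c R) Rr (covDivL2 c₀ c S) Q (LinearMap.adjoint Q) a hpos ∘ₗ
      LinearMap.adjoint Q = 0) (B : NegSize L η levB 0 W) :
    Rr (covDivL2 c₀ c S ((WL2.equiv ℝ (fun _ : Bond d Pd => c₀) W).symm
      (JetSup.equiv _ _ (covGrad c R) (HopLattice hpos hQ L η levB lev₀ lev₁ B)))) = 0 := by
  rw [equiv_HopLattice, H1flat_apply, Equiv.symm_apply_apply]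
  exact RDstar_H1Lattice hpos hQ h124' _

/-- **(46) for the assembled object**: if the two weighted row sums of the CONSTRUCTED kernel (values against `L^{j}η`, derived kernel against
`(L^{j}η)²`) are `≤ B₀` — the summed [5] (3.133), displayed — then `‖HB‖_{(115)} ≤ B₀·‖B‖`. [cite: Balaban1985Variational, (46) p.285] -/
theorem norm_HopLattice_le {B₀ : ℝ} (hB₀ : 0 ≤ B₀)
    (h₀ : ∀ b, rowSum (levWeight L η levB 0) (levWeight L η lev₀ 1) (kernelH1 hpos hQ) b ≤ B₀)
    (h₁ : ∀ p, rowSum (levWeight L η levB 0) (levWeight L η lev₁ 2) (gradKernel c R (kernelH1 hpos hQ)) p ≤ B₀)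
    (B : NegSize L η levB 0 W) : ‖HopLattice hpos hQ L η levB lev₀ lev₁ B‖ ≤ B₀ * ‖B‖ :=
  norm_Hop_le L η levB lev₀ lev₁ c R hB₀ h₀ h₁ B

/-- (46) VERBATIM for the assembled object: `L^{j(b)}η·|(HB)(b)| ≤ B₀|B|` and `(L^{j(p)}η)²·|(∇HB)(p)| ≤ B₀|B|` pointwise.
[cite: Balaban1985Variational, (46) p.285] -/
theorem HopLattice_pointwise {B₀ : ℝ} (hB₀ : 0 ≤ B₀)
    (h₀ : ∀ b, rowSum (levWeight L η levB 0) (levWeight L η lev₀ 1) (kernelH1 hpos hQ) b ≤ B₀)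
    (h₁ : ∀ p, rowSum (levWeight L η levB 0) (levWeight L η lev₁ 2) (gradKernel c R (kernelH1 hpos hQ)) p ≤ B₀)
    (B : NegSize L η levB 0 W) :
    (∀ b, L ^ lev₀ b * η * ‖JetSup.equiv _ _ (covGrad c R) (HopLattice hpos hQ L η levB lev₀ lev₁ B) b‖ ≤ B₀ * ‖B‖) ∧
      ∀ p, (L ^ lev₁ p * η) ^ 2 * ‖covGrad c R (JetSup.equiv _ _ (covGrad c R) (HopLattice hpos hQ L η levB lev₀ lev₁ B)) p‖ ≤ B₀ * ‖B‖ :=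
  Hop_pointwise L η levB lev₀ lev₁ c R hB₀ h₀ h₁ B

end IntoSpace115

end Literature.MathematicalPhysics.QuantumFieldTheory.Balaban1983to89.B11Eq45HOperatorLattice

end
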